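import Summits.NavierStokesRegularity.NavierStokesRegularity.Theorems.ExtremiserTransienceNearExtremalTransienceExtremiserLiouvilleConstantSpeedJetEndgame
import HarnessLib

/-!
# Crux `ExtremiserTransience.NearExtremalTransience` (stmt-NavierStokesRegularity-21883), line `extremiser_liouville`,
# stub K1b — THE JET KILL FROM EXPONENTIAL DECAY OF THE WINDOW DIRICHLET ENERGIES (record §3 (DEC) ⇒ §5, blueprint L7)

`--supports stmt-NavierStokesRegularity-21883` (helper).  Author: prover seat `ns-el-k1b` (g9).

`windowEnergy_nonpos_of_windowDirichlet_decay` (…JetEndgame, p722085) kills a jet whose window Dirichlet energies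
`D_H(r) = ∫H′(y₂ − r)‖∂₂V‖²` are SUMMABLY small far up (an `ε`-family of square-summable majorants).  The slide programme
delivers (DEC): `D_H(r) ≤ C e^{−r/L₀}` for `r ≥ r₀` (record §3).  This file is the bookkeeping between the two:
* `exists_summable_sq_bound_of_expDecay` : an exponentially decaying `f` admits, for every `ε > 0`, a height `s₀` and a
  summable `a ≥ 0` with `Σa ≤ ε` and `f(s₀ + k + t) ≤ a_k²` (`k ∈ ℕ`, `t ∈ [0,1]`) — `a_k = √(C e^{−s₀/L₀})·ρ^k`,
  `ρ = e^{−1/(2L₀)}`;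
* `windowEnergy_nonpos_of_expDecay` : **a bounded `C¹` field `V → 0` at infinity with square-integrable slabs,
  `∂₂V ∈ L²`, constant window energies `E₀` and (DEC) has `E₀ ≤ 0`** — so the residue JET (`E₀ > 0`) is dead once (DEC)
  is established (record §13: R6 ⇒ R7).

WHAT THIS IS NOT: K1b is NOT proved; nothing here proves NS regularity. [folklore]
-/

noncomputable section

open Set Filter Topology MeasureTheory Metric Function InnerProductSpace
open scoped ENNReal NNReal Topology InnerProductSpace RealInnerProductSpace ContDiff

namespace Summit.NavierStokesRegularity.NavierStokesRegularity.Theorems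

-- the problem directory repeats the summit name (`NavierStokesRegularity/NavierStokesRegularity`)
set_option linter.dupNamespace false

namespace ExtremiserLiouville

variable {V : EuclideanSpace ℝ (Fin 3) → EuclideanSpace ℝ (Fin 3)}

/-! ## 1. Exponential decay gives summable square-root majorants -/

/-- **Exponential decay ⇒ summably small windows.**  If `f(r) ≤ C e^{−r/L}` for `r ≥ r₀` (`C ≥ 0`, `L > 0`), then for
every `ε > 0` there are `s₀` and a summable `a ≥ 0` with `Σ a ≤ ε` and `f(s₀ + k + t) ≤ a_k²` for `k ∈ ℕ`, `t ∈ [0, 1]`.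
[folklore] -/
theorem exists_summable_sq_bound_of_expDecay {f : ℝ → ℝ} {C L r₀ : ℝ} (hC : 0 ≤ C) (hL : 0 < L)
    (hf : ∀ r, r₀ ≤ r → f r ≤ C * Real.exp (-r / L)) {ε : ℝ} (hε : 0 < ε) :
    ∃ (s₀ : ℝ) (a : ℕ → ℝ), (∀ k, 0 ≤ a k) ∧ Summable a ∧ (∑' k, a k) ≤ ε ∧
      ∀ (k : ℕ) (t : ℝ), t ∈ Icc (0 : ℝ) 1 → f (s₀ + k + t) ≤ (a k) ^ 2 := by
  set ρ : ℝ := Real.exp (-(1 / (2 * L))) with hρ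
  have hρ0 : 0 < ρ := Real.exp_pos _
  have hρ1 : ρ < 1 := by
    have h0 : 0 < 1 / (2 * L) := by positivity
    have := Real.exp_lt_exp.2 (show -(1 / (2 * L)) < 0 by linarith)
    rwa [Real.exp_zero] at this
  have hgeom : Summable fun k : ℕ => ρ ^ k := summable_geometric_of_lt_one hρ0.le hρ1
  have htg : (∑' k : ℕ, ρ ^ k) = (1 - ρ)⁻¹ := tsum_geometric_of_lt_one hρ0.le hρ1
  have h1ρ : 0 < 1 - ρ := by linarith
  -- the amplitude `√(C e^{−s/L})` tends to `0` as `s → ∞`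
  have hamp : Tendsto (fun s : ℝ => Real.sqrt (C * Real.exp (-s / L)) * (1 - ρ)⁻¹) atTop (𝓝 0) := by
    have h1 : Tendsto (fun s : ℝ => -s / L) atTop atBot := by
      have : Tendsto (fun s : ℝ => s / L) atTop atTop := tendsto_id.atTop_div_const hL
      refine (tendsto_neg_atTop_atBot.comp this).congr fun s => ?_
      simp [neg_div]
    have h2 : Tendsto (fun s : ℝ => Real.exp (-s / L)) atTop (𝓝 0) := Real.tendsto_exp_atBot.comp h1
    have h3 : Tendsto (fun s : ℝ => C * Real.exp (-s / L)) atTop (𝓝 0) := by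
      have := h2.const_mul C; rwa [mul_zero] at this
    have h4 : Tendsto (fun s : ℝ => Real.sqrt (C * Real.exp (-s / L))) atTop (𝓝 0) := by
      have := (Real.continuous_sqrt.tendsto 0).comp h3; rwa [Real.sqrt_zero] at this
    have := h4.mul_const (1 - ρ)⁻¹; rwa [zero_mul] at this
  obtain ⟨s₀, hs₀⟩ := ((hamp.eventually (ge_mem_nhds hε)).and (eventually_ge_atTop r₀)).exists
  obtain ⟨hsmall, hs₀r⟩ := hs₀
  set A : ℝ := Real.sqrt (C * Real.exp (-s₀ / L)) with hA
  have hA0 : 0 ≤ A := Real.sqrt_nonneg _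
  refine ⟨s₀, fun k => A * ρ ^ k, fun k => mul_nonneg hA0 (pow_nonneg hρ0.le k), hgeom.mul_left A, ?_, ?_⟩
  · rw [tsum_mul_left, htg]; exact hsmall
  · intro k t ht
    have hr : r₀ ≤ s₀ + k + t := by
      have hk : (0 : ℝ) ≤ k := Nat.cast_nonneg k
      linarith [ht.1]
    refine (hf _ hr).trans ?_
    -- `C e^{−(s₀+k+t)/L} ≤ C e^{−s₀/L} e^{−k/L} = (A ρ^k)²`
    have hρk : (ρ ^ k) ^ 2 = Real.exp (-(k : ℝ) / L) := by
      rw [hρ, ← Real.exp_nat_mul, ← Real.exp_nat_mul]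
      congr 1
      push_cast
      field_simp
    have hsq : (A * ρ ^ k) ^ 2 = C * Real.exp (-s₀ / L) * Real.exp (-(k : ℝ) / L) := by
      rw [mul_pow, hA, Real.sq_sqrt (mul_nonneg hC (Real.exp_pos _).le), hρk]
    rw [hsq, mul_assoc, ← Real.exp_add]
    refine mul_le_mul_of_nonneg_left (Real.exp_le_exp.2 ?_) hC
    rw [← add_div, div_le_div_iff_of_pos_right hL]
    linarith [ht.1]

/-! ## 2. The jet kill from (DEC) -/

/-- **THE JET KILL FROM (DEC).**  A bounded `C¹` field `V` on `ℝ³` with `V → 0` at infinity, all slabs `{|x₂| ≤ T}`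
square integrable, `∂₂V ∈ L²`, constant window energies `∫H′(x₂−s)‖V‖² = E₀`, and EXPONENTIALLY DECAYING window
Dirichlet energies far up — `∫H′(y₂ − r)‖∂₂V‖² ≤ C e^{−r/L}` for `r ≥ r₀` (the conclusion (DEC) of the slide bookkeeping,
record §3) — has `E₀ ≤ 0`.  For the K1b residue JET (`E₀ > 0`) this is the contradiction. [folklore] -/
theorem windowEnergy_nonpos_of_expDecay (hV : ContDiff ℝ 1 V) {Cv : ℝ} (hVb : ∀ x, ‖V x‖ ≤ Cv)
    (hfar : Tendsto V (cocompact (EuclideanSpace ℝ (Fin 3))) (𝓝 0))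
    (hslab : ∀ T : ℝ, 0 < T →
      Integrable (fun x => {x : EuclideanSpace ℝ (Fin 3) | |x 2| ≤ T}.indicator (fun x => ‖V x‖ ^ 2) x) volume)
    (hD2 : Integrable (fun x => ‖fderiv ℝ V x (EuclideanSpace.single (2 : Fin 3) (1 : ℝ))‖ ^ 2) volume)
    {E₀ : ℝ} (hE : ∀ s : ℝ, (∫ x, deriv Real.smoothTransition (x 2 - s) * ‖V x‖ ^ 2) = E₀)
    {C L r₀ : ℝ} (hC : 0 ≤ C) (hL : 0 < L)
    (hdec : ∀ r : ℝ, r₀ ≤ r →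
      (∫ y, deriv Real.smoothTransition (y 2 - r) * ‖fderiv ℝ V y (EuclideanSpace.single (2 : Fin 3) (1 : ℝ))‖ ^ 2) ≤
        C * Real.exp (-r / L)) :
    E₀ ≤ 0 :=
  windowEnergy_nonpos_of_windowDirichlet_decay hV hVb hfar hslab hD2 hE fun _ε hε =>
    exists_summable_sq_bound_of_expDecay
      (f := fun r => ∫ y, deriv Real.smoothTransition (y 2 - r) * ‖fderiv ℝ V y (EuclideanSpace.single (2 : Fin 3) (1 : ℝ))‖ ^ 2)
      hC hL hdec hε

/-! ## 3. The jet kill from power decay (the compactly supported-weight route of R6b) -/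

/-- **Power decay ⇒ summably small windows.**  If `f(r) ≤ C/r⁴` for `r ≥ r₀` (`C ≥ 0`), then for every `ε > 0` there are `s₀`
and a summable `a ≥ 0` with `Σ a ≤ ε` and `f(s₀ + k + t) ≤ a_k²` for `k ∈ ℕ`, `t ∈ [0, 1]` (`a_k = √C/(s₀ + k)²`, `s₀ ∈ ℕ` large).
This is the input form of `windowEnergy_nonpos_of_windowDirichlet_decay` for the ITERATED (faster-than-any-power) decay that the
compactly supported layer weights of (INEQ)₃ produce (record §3, last sentence; §18). [folklore] -/
theorem exists_summable_sq_bound_of_quarticDecay {f : ℝ → ℝ} {C r₀ : ℝ} (hC : 0 ≤ C)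
    (hf : ∀ r, r₀ ≤ r → f r ≤ C / r ^ 4) {ε : ℝ} (hε : 0 < ε) :
    ∃ (s₀ : ℝ) (a : ℕ → ℝ), (∀ k, 0 ≤ a k) ∧ Summable a ∧ (∑' k, a k) ≤ ε ∧
      ∀ (k : ℕ) (t : ℝ), t ∈ Icc (0 : ℝ) 1 → f (s₀ + k + t) ≤ (a k) ^ 2 := by
  set b : ℕ → ℝ := fun n => 1 / (n : ℝ) ^ 2 with hb
  have hbs : Summable b := Real.summable_one_div_nat_pow.mpr (by norm_num)
  have hb0 : ∀ n, 0 ≤ b n := fun n => by positivity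
  -- tails of `Σ b` are small, uniformly after a large shift
  have htail : Tendsto (fun i : ℕ => Real.sqrt C * ∑' k, b (k + i)) atTop (𝓝 0) := by
    have := (tendsto_sum_nat_add b).const_mul (Real.sqrt C); rwa [mul_zero] at this
  obtain ⟨N, hN⟩ := ((htail.eventually (ge_mem_nhds hε)).and (eventually_ge_atTop ⌈max r₀ 1⌉₊)).exists
  obtain ⟨hNε, hNr⟩ := hN
  have hN1 : (1 : ℝ) ≤ N := by
    have h : (⌈max r₀ 1⌉₊ : ℝ) ≤ N := by exact_mod_cast hNr
    exact ((le_max_right r₀ 1).trans (Nat.le_ceil _)).trans h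
  have hNr₀ : r₀ ≤ N := by
    have h : (⌈max r₀ 1⌉₊ : ℝ) ≤ N := by exact_mod_cast hNr
    exact ((le_max_left r₀ 1).trans (Nat.le_ceil _)).trans h
  refine ⟨N, fun k => Real.sqrt C * b (k + N), fun k => mul_nonneg (Real.sqrt_nonneg _) (hb0 _),
    ((summable_nat_add_iff N).mpr hbs).mul_left _, ?_, ?_⟩
  · rw [tsum_mul_left]; exact hNε
  · intro k t ht
    have hpos : 0 < (N : ℝ) + k := by positivity
    have hr : r₀ ≤ (N : ℝ) + k + t := by linarith [ht.1, (Nat.cast_nonneg k : (0 : ℝ) ≤ k)]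
    refine (hf _ hr).trans ?_
    have hsq : (Real.sqrt C * b (k + N)) ^ 2 = C / ((N : ℝ) + k) ^ 4 := by
      rw [mul_pow, Real.sq_sqrt hC, hb]
      push_cast
      have : ((k : ℝ) + N) ≠ 0 := by positivity
      field_simp
      ring
    rw [hsq]
    have h4 : ((N : ℝ) + k) ^ 4 ≤ ((N : ℝ) + k + t) ^ 4 := pow_le_pow_left₀ hpos.le (by linarith [ht.1]) 4
    exact div_le_div_of_nonneg_left hC (pow_pos hpos 4) h4

/-- **THE JET KILL FROM POWER DECAY.**  As `windowEnergy_nonpos_of_expDecay`, with the window Dirichlet energies decaying like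
`C/r⁴` far up (the output of the iterated layer inequality for compactly supported weights): `E₀ ≤ 0`. [folklore] -/
theorem windowEnergy_nonpos_of_quarticDecay (hV : ContDiff ℝ 1 V) {Cv : ℝ} (hVb : ∀ x, ‖V x‖ ≤ Cv)
    (hfar : Tendsto V (cocompact (EuclideanSpace ℝ (Fin 3))) (𝓝 0))
    (hslab : ∀ T : ℝ, 0 < T →
      Integrable (fun x => {x : EuclideanSpace ℝ (Fin 3) | |x 2| ≤ T}.indicator (fun x => ‖V x‖ ^ 2) x) volume)
    (hD2 : Integrable (fun x => ‖fderiv ℝ V x (EuclideanSpace.single (2 : Fin 3) (1 : ℝ))‖ ^ 2) volume)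
    {E₀ : ℝ} (hE : ∀ s : ℝ, (∫ x, deriv Real.smoothTransition (x 2 - s) * ‖V x‖ ^ 2) = E₀)
    {C r₀ : ℝ} (hC : 0 ≤ C)
    (hdec : ∀ r : ℝ, r₀ ≤ r →
      (∫ y, deriv Real.smoothTransition (y 2 - r) * ‖fderiv ℝ V y (EuclideanSpace.single (2 : Fin 3) (1 : ℝ))‖ ^ 2) ≤
        C / r ^ 4) :
    E₀ ≤ 0 :=
  windowEnergy_nonpos_of_windowDirichlet_decay hV hVb hfar hslab hD2 hE fun _ε hε =>
    exists_summable_sq_bound_of_quarticDecay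
      (f := fun r => ∫ y, deriv Real.smoothTransition (y 2 - r) * ‖fderiv ℝ V y (EuclideanSpace.single (2 : Fin 3) (1 : ℝ))‖ ^ 2)
      hC hdec hε

end ExtremiserLiouville

end Summit.NavierStokesRegularity.NavierStokesRegularity.Theorems

end
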